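import Summits.AtomisticToContinuum.FouriersLaw.Theses.PhononMeanFreePath
import Summits.AtomisticToContinuum.FouriersLaw.Theorems.CoherentDephasing.Negative.ScalingNormalForm

/-!
# Disproof attempts for `CoherentDephasing` (stmt-AtomisticToContinuum-11810) — findings

Standing adversary file (refuter, cdisprove mode) for the crux
`Summit.AtomisticToContinuum.FouriersLaw.Theses.PhononMeanFreePath.CoherentDephasing`:
for the pinned anharmonic chain `pinnedChain ω₂ lam β γ` (all `> 0`) at temperature `T > 0`,
with `r_N(t) = ∫ p₀ · (K_t p_N) dμ_T` (Gibbs × constructed Langevin kernel of the `N+1`-site chain),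
`t ↦ r_N(t)²` is integrable on `(0,∞)` for every `N` and `N · ∫₀^∞ r_N² → 0`.

VERDICT (cycle 1, 2026-08-16): **no kill**. The objects are genuine (no interface / zero-measure junk
under the hypotheses), the claim is an open problem of "finite thermal phonon mean free path" type;
every cheap attack below either confirms a junk-level equivalence (§1), reduces to the (unproved but
true) harmonic calibration (§3), or is a normal form (§8, PROVED and landed); and the complete MD scan
(81 points, NUMERICAL FALSIFIER below) shows exponential closing of the coherent channel at every
coupling with no plateau, `0 < lam` load-bearing and `0 < β` dispensable numerically, and no
re-coherence on heating inside the family. Landed negative-side lemmas: `Negative/LoadBearing.lean`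
(p73202), `Negative/KillSwitches.lean` (p73936), `Negative/ScalingNormalForm.lean` (p74693, rev 2
p75808). Index:

* §0 `rN`, `SliceAt`, `coherentDephasing_iff` — read-back of the crux, by `Iff.rfl`.
* §1 `0 < T` is NOT load-bearing at the Lean level: for `T ≤ 0` the Gibbs measure of the pinned
  chain is the ZERO measure (`pinnedChain_gibbsMeasure_succ_eq_zero_of_nonpos`), so `r_N ≡ 0` and the
  `T`-slice holds trivially (`sliceAt_of_nonpos`); hence `CoherentDephasingAllT ↔ CoherentDephasing`
  (`coherentDephasingAllT_iff`). Provers: no case split on the sign of `T` is ever useful; refuters: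
  no counterexample lives at `T ≤ 0`.
* §2 the `N = 0` term of the sequence is `0` (factor `N`); the one-site chain never matters for the
  limit, only for the integrability clause (`term_zero`).
* §3 LOAD-BEARING HYPOTHESES. Anharmonicity (`0 < lam`, `0 < β` jointly) is load-bearing:
  `coherentDephasingWithoutAnharmonicity_false_of_persistence :
     HarmonicCoherentPersistence → ¬ CoherentDephasingWithoutAnharmonicity` (pure logic; the
  hypothesis is the route's own calibration item stmt-11814, Rieder–Lebowitz–Lieb ballistic
  transport, true but not yet in the tree for the constructed kernels). Single drops are recorded as
  documented `Prop`s with the physics verdict (no Lean kill available: every variant is an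
  `N → ∞` statement about SDE kernels): `0 < β` alone — conjecturally unnecessary (φ⁴-type chain,
  on-site quartic vertex damps every wavenumber); `0 < lam` alone — conjecturally unnecessary for the
  LIMIT but load-bearing for the conjectured exponential RATE (the FPU-β vertex vanishes at `k → 0`,
  long waves are asymptotically transparent, `ℓ(k) → ∞`); `0 < γ` — essential (γ = 0 is the closed
  Hamiltonian chain; γ < 0 is junk: zero noise, anti-damping); `0 < ω₂` — used by the tree's kernel
  API (coercivity), not by the physics (quartic pinning alone still pins).
* §4 NATURAL STRENGTHENINGS that are false or doubtful (documented, not claimable as kills):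
  uniformity in `T` (the scaling conjugacy `(lam, β, T) ≡ (lam·T, β·T, 1)` makes `T → 0` the harmonic
  limit, `ℓ(T) → ∞`); uniformity in `(lam, β)` near `0` (same).
* §5 WHY IT RESISTS (paper analysis, recorded for the provers): `r_N` lives in the sector ODD under
  the phase-space inversion `S : (q,p) ↦ (-q,-p)` (U, V even ⇒ `S` commutes with the dynamics and
  preserves Gibbs), while every functional of the conserved energy field is `S`-even; so no
  hydrodynamic (diffusive, `O(1/N)`) floor is forced on `∫ r_N²`, and pinning removes the only odd
  conserved candidate (momentum). A refutation needs an ODD slow mode of the thermal anharmonic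
  chain (coherent nonlinear carrier surviving thermal averaging) — none is known or expected.
  Kinetic theory gives no transparent band for on-site anharmonicity: "both the total collision
  cross section and the relaxation time function V are formally infinite for all k₀"
  (Lukkarinen 2016, arXiv:1509.06036, p. 25 = §3.3 of the printed version) — the d = 1 collinear
  singularity makes the second-order one-phonon loss rate +∞ at EVERY wavenumber, i.e. damping is, if
  anything, faster than exponential on the kinetic scale; nothing is proved beyond kinetic times.
* §6 SUM RULES CANNOT SEE THE COHERENT CHANNEL (paper identities, assuming only Gibbs reversibility
  of the constructed kernels, `⟨f, K_t g⟩_{μ_T} = ⟨Θg, K_t Θf⟩_{μ_T}` with `Θ(q,p) = (q,-p)` — true in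
  substance (detailed balance of the equal-temperature Langevin chain), not yet in the tree): with
  `R(t) = ⟨p₀, K_t q_N⟩`, `R' = r_N`, `R(0) = R(∞) = 0`, one gets `∫₀^∞ r_N = 0` and
  `∫₀^∞ t·r_N(t) dt = -Cov_{μ_T}(q₀, q_N)`, a STATIC end-to-end position covariance, exponentially
  small in `N` (gapped transfer operator) for the harmonic AND the anharmonic chain alike. So no
  Cauchy–Schwarz lower bound `(∫ w r_N)² ≤ ∫w² ∫r_N²` from low time-moments can separate the two
  cases: a refutation must look at `∫ r_N²` itself (Parseval: `(1/π)∫₀^∞ |r̂_N(ω)|² dω`, the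
  transmission band), which is what HarmonicCoherentPersistence does at `lam = β = 0`.
* §8 SCALING NORMAL FORM (PROVED, landed as `Theorems/CoherentDephasing/Negative/ScalingNormalForm.lean`):
  the amplitude scaling `(q,p) ↦ (s q, s p)` conjugates the CONSTRUCTED kernels and Gibbs measures
  (pathwise flow by uniqueness of the Langevin integral equation; `Measure.integral_comp_smul` for the
  tilted Lebesgue measure), so `r_N(t; lam, β, T) = T · r_N(t; lam T, β T, 1)` (`rN_eq_temp_mul_unit`
  — the `ScalingCovariance` first lemma of cards scaling-ward-monotone-transfer /
  heating-never-recoheres, now a theorem), `SliceAt ω₂ lam β γ T ↔ SliceAt ω₂ (lam T) (β T) γ 1`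
  (`sliceAt_iff_unit`) and **the crux is its `T = 1` slice over all couplings**
  (`coherentDephasing_iff_unitTemperature`): the quantifier `∀ T > 0` is redundant, the temperature
  axis IS the coupling ray, a counterexample search need only scan couplings at `T = 1`, and every
  `T`-uniform / `T`-monotone strengthening (§4; the cards' `HeatingNeverRecoheres`,
  `RayGrowthBound`) is a statement along coupling rays `g ↦ (g a, g b)`; and the weak-coupling
  support item stmt-11813 is exactly the small-coupling CORNER `a, b ≤ ε₀` of the normal form
  (`weakCoupling_iff_corner`) — the route's regime split is a split of the coupling quadrant at
  `T = 1`.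
* LANDED (gate): `Theorems/CoherentDephasing/Negative/LoadBearing.lean` (p73202; §1–§3 without the
  work-file `def`s: `pinnedChain_gibbsMeasure_succ_eq_zero_of_nonpos`, `coherentDephasing_iff_allT`,
  `crux_false_without_anharmonicity_of_persistence`), `…/Negative/KillSwitches.lean` (p73936; §7),
  `…/Negative/ScalingNormalForm.lean` (p74693; §8; rev 2 p75808 adds
  `coherentDephasingWeakCoupling_iff_corner` — 11813 is the small-coupling corner of the `T = 1`
  normal form — and `harmonicCoherentPersistence_iff_unit` — 11814 reduces to `T = 1`).
* §7 KILL SWITCHES (formal versions of the route's kill criteria): `∫ r_N² ↛ 0` at one admissible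
  point (`not_sliceAt_of_not_tendsto_integral`), a `c/N` floor for infinitely many `N`
  (`not_sliceAt_of_frequently_ge`), or non-integrability of `r_N²` at one `N`
  (`not_sliceAt_of_not_integrableOn`) each refute the crux (`not_coherentDephasing_of_not_sliceAt`).
* `-- Targets`: none yet (no line picked, no stuck stubs handed over).
* NUMERICAL FALSIFIER — COMPLETE SCAN (equilibrium Langevin MD, BAOAB `dt = 0.02`, `ω₂ = γ = 1`,
  `R = 64` replicas × `L = 10⁵` per point, unbiased cross-replica U-statistic for `I_N := ∫₀^∞ r_N²`
  with jackknife errors; kit j007937, j008037, j014774–j014777, 2026-08-16; script `mdjob/main.py` +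
  `analyze.py` in the cdisprove folder, merged table attached to the item as `md_merged_results.json`).
  By §8 the temperature scan at `lam = β = 1` IS the coupling-ray scan `g = T` at unit temperature and
  `S_N/T²` is the scale-free functional (`= N ∫ r_N²` at `(g, g, 1)`).
  - CALIBRATION: exact harmonic `I_N = T²/16` for `N ≥ 16` (Lyapunov: `0.08333, 0.06818, 0.06287,
    0.06250, 0.0625…` at `T = 1` for `N = 1, 2, 4, 8, 16…`; `S_N = N T²/16 → ∞`, RLL ballistic); the
    MD estimator gives `0.06311(18), 0.06250(140), 0.06192(19), 0.06146(20)` at `N = 4, 8, 16, 32`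
    (ratio `1.004, 1.000, 0.991, 0.983` — the last two low by the finite time window `4N + 200`
    cutting the dispersive harmonic tails; the anharmonic pulses have no such tails: cumulative
    quartiles of `∫ r_N²` are flat after the arrival at `t ≈ 1.2–1.5 N`).
  - FULL CHAIN `lam = β = 1`: clean EXPONENTIAL closing `I_N ≈ A e^{-N/L(g)}` over 3–4 decades at
    every coupling, then zero within errors:
      `g = 0.5`: `I_N = 1.38e-2, 8.00e-3, 2.62e-3, 8.44e-4, 2.86e-4, 3.29e-5, 4.0(1.2)e-6, ≈0, ≈0`
                 for `N = 4, 8, 16, 24, 32, 48, 64, 96, 128`; `L = 7.4`;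
      `g = 1`:   `5.03e-2, 2.24e-2, 4.17e-3, 7.52e-4, 1.34e-4, ≈0 (2±3e-6), …`; `L = 4.7`;
      `g = 2`:   `1.84e-1, 6.33e-2, 6.29e-3, 5.65e-4, 4.0(1.2)e-5, ≈0, …`; `L = 3.2`;
      `g = 4`:   `6.81e-1, 1.85e-1, 1.04e-2, 5.7e-4, ≈0, …`; `L = 2.8`;
      `g = 8`:   `2.53, 5.69e-1, 2.02e-2, 5.4e-4, ≈0, …`; `L = 2.2`
    (amplitude mean free path `ℓ ≈ 2L ≈ 15 … 4.4` sites; `L ∝ g^{-0.44}`, far slower than the kinetic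
    `g⁻²` — these couplings are beyond the kinetic corner — and monotonically DECREASING in `g`).
    Scale-free `S_N/T²` at `N = 4/8/16/24/32/48/64/128`:
      `g = 0.5`: `.221 .256 .168 .081 .037 .0063 .0010 ≈0`;  `g = 1`: `.201 .179 .067 .018 .0043 ≈0 …`;
      `g = 2`: `.184 .127 .025 .0034 .0003 ≈0 …`;  `g = 4`: `.170 .092 .010 .0009 ≈0 …`;
      `g = 8`: `.158 .071 .0050 .0002 ≈0 …` — `→ 0` at every coupling, `|S_128| < 6·10⁻⁴ T²`
    everywhere. NO PLATEAU, NO KILL SIGNAL; moreover `S_N/T²` is MONOTONE DECREASING IN `g` AT EVERY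
    FIXED `N` measured (the §4 strengthening `SliceMonotoneInT` is NOT violated on the diagonal ray,
    contrary to my small-`N` guess) and `L(g)` is decreasing: on the ray `lam = β` the cards'
    `HeatingNeverRecoheres` / `RayGrowthBound` (even with `C = 0`) pass.
  - SINGLE DROPS at `g = 2`: `lam = 1, β = 0` (φ⁴-type): `I_16 = 3.9(3)e-4`, `I_32, I_64, I_128 ≈ 0`
    — closes even FASTER than the full chain (`0 < β` dispensable; adding `β r⁴` stiffens the bonds
    and lengthens coherence). `lam = 0, β = 1` (pinned FPU-β): `I_N = .230, .142, .0745, .0321,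
    .0177, .0110` at `N = 8, 16, 32, 64, 96, 128` (`92 % … 4.4 %` of ballistic), `S_N/T² = .46, .57,
    .60, .51, .43, .35` — a maximum near `N ≈ 32`, then a slow POWER-LAW decline (`S ∝ N^{-0.4}`),
    attenuation length `L ≈ 45`; and along ITS coupling ray the lam = 0 chain RE-COHERES:
    `L = 56, 45, 54` and `S_128/T² = .53, .35, .49` at `g = 0.5, 2, 8` (NON-monotone: strong gradient
    anharmonicity stiffens the chain relative to its pinning and re-opens the acoustic window). So
    `0 < lam` (on-site anharmonicity) is the numerically load-bearing hypothesis, as predicted in §3;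
    the `lam = 0` variant may still tend to `0`, but at most like a power law and non-monotonically
    in the coupling.
  - RAYS `lam : β = 0.3` and `0.1` (kit j014957–9): scale-free `S_N/T²` at `g = 0.5 / 2 / 8`:
    ray 0.3 — `N = 16: .431 .222 .122`, `32: .319 .054 .0094`, `64: .0945 .0014 ≈0`;
    ray 0.1 — `N = 16: .554 .430 .375`, `32: .577 .291 .157`, `64: .406 .079 .013`,
    `128: .144 .0027 ≈0` — MONOTONE DECREASING IN `g` AT EVERY `N` on both rays (and monotone in
    `lam` at fixed `(β, g)`), the decay accelerating with `N` as the on-site scattering takes over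
    from the transparent-long-wave regime (ray 0.1, `g = 0.5`: local `L(64→128) ≈ 37`; `g = 2`: `16`).
    VERDICT ON THE STRENGTHENINGS: inside the crux's family (`lam > 0`) no re-coherence on heating is
    seen anywhere in `0.1 ≤ lam/β ≤ 1`, `0.5 ≤ g ≤ 8`, `N ≤ 128`: `SliceMonotoneInT` (§4) and the
    cards' `HeatingNeverRecoheres` / `RayGrowthBound` are NOT refuted (my small-`N` guess was wrong);
    the non-monotone re-coherence lives exactly on the excluded boundary `lam = 0`. The full merged
    table (81 points) and `analyze.py` output are attached to the item (`md_merged_results.json`,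
    `md_analysis.txt`).
-/

noncomputable section

namespace Summit.AtomisticToContinuum.FouriersLaw.Cruxes.CoherentDephasing.Disproof

open MeasureTheory Filter Topology Set
open Literature.MathematicalPhysics.KineticTheory.HeatConduction
open Summit.AtomisticToContinuum.FouriersLaw.Theses.PhononMeanFreePath

/-! ### §0 Read-back -/

/-- `r_N(t) = ∫ p₀ · (K_t p_N) dμ_T` for the `(N+1)`-site chain `pinnedChain ω₂ lam β γ` at
temperature `T` (both baths at `T`): the Gibbs- and noise-averaged end-to-end momentum pair
correlation `⟨p₀(0) p_N(t)⟩`, i.e. `T ×` the mean response of `p_N(t)` to a unit kick on `p₀`.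
[folklore] -/
def rN (ω₂ lam β γ T : ℝ) (N : ℕ) (t : ℝ) : ℝ :=
  ∫ z, z.2 0 * (∫ y, y.2 (Fin.last N)
    ∂((pinnedChain ω₂ lam β γ).transitionKernel (N + 1) T T t.toNNReal z))
    ∂((pinnedChain ω₂ lam β γ).gibbsMeasure (N + 1) T)

/-- The `T`-slice of the crux at fixed parameters: integrability of `r_N²` on `(0,∞)` for all `N`
and `N ∫₀^∞ r_N² → 0`. [folklore] -/
def SliceAt (ω₂ lam β γ T : ℝ) : Prop :=
  (∀ N : ℕ, IntegrableOn (fun t : ℝ => rN ω₂ lam β γ T N t ^ 2) (Ioi 0)) ∧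
    Tendsto (fun N : ℕ => (N : ℝ) * ∫ t in Ioi (0 : ℝ), rN ω₂ lam β γ T N t ^ 2) atTop (𝓝 0)

/-- Read-back: the crux is, definitionally, `SliceAt` at every admissible parameter point.
[folklore] -/
theorem coherentDephasing_iff :
    CoherentDephasing ↔ ∀ ω₂ lam β γ : ℝ, 0 < ω₂ → 0 < lam → 0 < β → 0 < γ →
      ∀ T : ℝ, 0 < T → SliceAt ω₂ lam β γ T :=
  Iff.rfl

/-! ### §1 The hypothesis `0 < T` is not load-bearing (zero Gibbs measure for `T ≤ 0`) -/

/-- Lebesgue measure of the phase space of `n + 1` oscillators is infinite. [folklore] -/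
theorem volume_phaseSpace_univ (n : ℕ) : (volume : Measure (PhaseSpace (n + 1))) univ = ⊤ := by
  rw [MeasureTheory.Measure.volume_eq_prod, ← univ_prod_univ, Measure.prod_prod]
  have h : (volume : Measure (Fin (n + 1) → ℝ)) univ = ⊤ := by
    rw [volume_pi, ← Set.pi_univ, Measure.pi_pi]
    simp
  rw [h]
  simp

/-- The energy of the pinned chain is nonnegative for `ω₂, lam, β ≥ 0`. [folklore] -/
theorem pinnedChain_hamiltonian_nonneg' {ω₂ lam β : ℝ} (γ : ℝ) (hω : 0 ≤ ω₂) (hl : 0 ≤ lam)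
    (hβ : 0 ≤ β) (n : ℕ) (x : PhaseSpace n) : 0 ≤ (pinnedChain ω₂ lam β γ).hamiltonian n x := by
  unfold OscillatorChain.hamiltonian
  refine add_nonneg (Finset.sum_nonneg fun i _ => ?_)
    (Finset.sum_nonneg fun i _ => Finset.sum_nonneg fun j _ => ?_)
  · simp only [pinnedChain]; positivity
  · split_ifs
    · simp only [pinnedChain]; positivity
    · exact le_rfl

/-- For `T ≤ 0` (and `ω₂, lam, β ≥ 0`, so that `H ≥ 0`) the Gibbs density `e^{-H/T}` is `≥ 1`,
hence not Lebesgue integrable on the (infinite-volume) phase space of `n + 1` sites. [folklore] -/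
theorem pinnedChain_not_integrable_gibbsDensity_of_nonpos {ω₂ lam β : ℝ} (γ : ℝ) (hω : 0 ≤ ω₂)
    (hl : 0 ≤ lam) (hβ : 0 ≤ β) (n : ℕ) {T : ℝ} (hT : T ≤ 0) :
    ¬ Integrable ((pinnedChain ω₂ lam β γ).gibbsDensity (n + 1) T) := by
  intro hint
  have hge : ∀ x, (1 : ℝ) ≤ (pinnedChain ω₂ lam β γ).gibbsDensity (n + 1) T x := by
    intro x
    have hH := pinnedChain_hamiltonian_nonneg' γ hω hl hβ (n + 1) x
    have harg : 0 ≤ -(pinnedChain ω₂ lam β γ).hamiltonian (n + 1) x / T := by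
      rcases eq_or_lt_of_le hT with h0 | hneg
      · simp [h0]
      · exact div_nonneg_of_nonpos (by linarith) hneg.le
    simpa [OscillatorChain.gibbsDensity] using Real.one_le_exp harg
  have hone : Integrable (fun _ : PhaseSpace (n + 1) => (1 : ℝ)) := by
    refine hint.mono' ?_ (Filter.Eventually.of_forall fun x => ?_)
    · exact aestronglyMeasurable_const
    · rw [Real.norm_eq_abs, abs_one]
      exact hge x
  rcases integrable_const_iff.1 hone with h | h
  · exact one_ne_zero h
  · have hlt := @measure_lt_top _ _ (volume : Measure (PhaseSpace (n + 1))) h univ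
    rw [volume_phaseSpace_univ] at hlt
    exact lt_irrefl _ hlt

/-- **Zero Gibbs measure at `T ≤ 0`.** For `ω₂, lam, β ≥ 0` and `T ≤ 0` the Gibbs measure of the
`(n+1)`-site pinned chain is the zero measure (Mathlib's `tilted` convention). [folklore] -/
theorem pinnedChain_gibbsMeasure_succ_eq_zero_of_nonpos {ω₂ lam β : ℝ} (γ : ℝ) (hω : 0 ≤ ω₂)
    (hl : 0 ≤ lam) (hβ : 0 ≤ β) (n : ℕ) {T : ℝ} (hT : T ≤ 0) :
    (pinnedChain ω₂ lam β γ).gibbsMeasure (n + 1) T = 0 :=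
  (pinnedChain ω₂ lam β γ).gibbsMeasure_of_not_integrable
    (pinnedChain_not_integrable_gibbsDensity_of_nonpos γ hω hl hβ n hT)

/-- At `T ≤ 0` the pair correlation is identically zero (integral against the zero measure).
[folklore] -/
theorem rN_of_nonpos {ω₂ lam β : ℝ} (γ : ℝ) (hω : 0 ≤ ω₂) (hl : 0 ≤ lam) (hβ : 0 ≤ β) {T : ℝ}
    (hT : T ≤ 0) (N : ℕ) (t : ℝ) : rN ω₂ lam β γ T N t = 0 := by
  simp only [rN, pinnedChain_gibbsMeasure_succ_eq_zero_of_nonpos γ hω hl hβ N hT, integral_zero_measure]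

/-- **The `T`-slice holds trivially for `T ≤ 0`** (nothing to refute there, nothing to prove there).
[folklore] -/
theorem sliceAt_of_nonpos {ω₂ lam β : ℝ} (γ : ℝ) (hω : 0 ≤ ω₂) (hl : 0 ≤ lam) (hβ : 0 ≤ β) {T : ℝ}
    (hT : T ≤ 0) : SliceAt ω₂ lam β γ T := by
  refine ⟨fun N => ?_, ?_⟩
  · simp only [rN_of_nonpos γ hω hl hβ hT]
    simp
  · simp only [rN_of_nonpos γ hω hl hβ hT]
    simp

/-- The crux with the hypothesis `0 < T` DROPPED. [folklore] -/
def CoherentDephasingAllT : Prop :=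
  ∀ ω₂ lam β γ : ℝ, 0 < ω₂ → 0 < lam → 0 < β → 0 < γ → ∀ T : ℝ, SliceAt ω₂ lam β γ T

/-- **`0 < T` is not load-bearing**: dropping it gives an equivalent statement, because the
`T ≤ 0` slices are junk-true. (So `CoherentDephasingWithout(0<T)` is NOT refutable, and a proof of
the crux may ignore the sign of `T` only in the sense that the extra cases are free.) [folklore] -/
theorem coherentDephasingAllT_iff : CoherentDephasingAllT ↔ CoherentDephasing := by
  refine ⟨fun h ω₂ lam β γ hω hl hβ hγ T _ => h ω₂ lam β γ hω hl hβ hγ T, ?_⟩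
  intro h ω₂ lam β γ hω hl hβ hγ T
  by_cases hT : 0 < T
  · exact h ω₂ lam β γ hω hl hβ hγ T hT
  · exact sliceAt_of_nonpos γ hω.le hl.le hβ.le (not_lt.1 hT)

/-! ### §2 The `N = 0` term -/

/-- The first term of the sequence `N ↦ N ∫ r_N²` vanishes identically (factor `N = 0`): the
one-site chain (both baths on site `0`) enters the crux only through the integrability clause.
[folklore] -/
theorem term_zero (ω₂ lam β γ T : ℝ) :
    ((0 : ℕ) : ℝ) * ∫ t in Ioi (0 : ℝ), rN ω₂ lam β γ T 0 t ^ 2 = 0 := by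
  simp

/-! ### §3 Load-bearing hypotheses -/

/-- The crux with anharmonicity DROPPED (`lam = β = 0` allowed): the `T`-slice for the pinned
HARMONIC chain `pinnedChain ω₂ 0 0 γ`. [folklore] -/
def CoherentDephasingWithoutAnharmonicity : Prop :=
  ∀ ω₂ γ : ℝ, 0 < ω₂ → 0 < γ → ∀ T : ℝ, 0 < T → SliceAt ω₂ 0 0 γ T

/-- **Anharmonicity is load-bearing (modulo the route's calibration item).** The harmonic corner
of the crux contradicts `HarmonicCoherentPersistence` (stmt-11814: at `lam = β = 0`,
`N ∫ r_N² ↛ 0` — Rieder–Lebowitz–Lieb ballistic conductance, `2γ²T⁻² ∫ r_N² → c_∞ > 0`).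
Pure logic; the calibration item itself is true in substance (the OU process is Gaussian; Parseval
on the RLL transmission formula; tree: `HarmonicChainBallisticFlux_holds`, `fluxCoeff`,
`tendsto_fluxCoeff`) but awaits the identification of `transitionKernel` at `lam = β = 0` with the
OU law. Any proof of the crux must therefore USE `0 < lam ∨ 0 < β`. [folklore] -/
theorem coherentDephasingWithoutAnharmonicity_false_of_persistence
    (h : HarmonicCoherentPersistence) : ¬ CoherentDephasingWithoutAnharmonicity := by
  intro hA
  obtain ⟨_, hnot⟩ := h 1 1 one_pos one_pos 1 one_pos
  exact hnot (hA 1 1 one_pos one_pos 1 one_pos).2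

/-- The crux with `0 < β` dropped (`β = 0`: the φ⁴-type chain, quartic pinning + harmonic
coupling). PHYSICS VERDICT: conjecturally TRUE (not load-bearing) — the on-site quartic vertex is
momentum-independent, so the thermal one-phonon damping rate `Γ(k)` is bounded below on the whole
band (with pinning the 2↔2 resonant manifold is non-trivial at every `k`, Lukkarinen 2016 §2.2,
and the d = 1 second-order rate is even formally infinite, §3.3); normal conductivity of the φ⁴
chain is the standard numerical fact (Aoki–Kusnezov 2000, Aoki–Lukkarinen–Spohn 2006). No Lean
kill available. NB: for `β = 0` CEHR condition C5 (interaction degree ≥ pinning degree) FAILS, so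
even fixed-`N` exponential mixing (hence the integrability clause) loses its printed support
(Hairer–Mattingly 2009 slow energy dissipation) — a prover dropping `β` inherits that. MD (kit
j008037, `T = 2`, `N = 128`, `lam = 1`, `β = 0`): `S_128 = 2.3(2.3)·10⁻³`, closed exactly like the
full chain — numerically NOT load-bearing. [folklore] -/
def CoherentDephasingWithoutPosBeta : Prop :=
  ∀ ω₂ lam γ : ℝ, 0 < ω₂ → 0 < lam → 0 < γ → ∀ T : ℝ, 0 < T → SliceAt ω₂ lam 0 γ T

/-- The crux with `0 < lam` dropped (`lam = 0`: harmonic pinning + FPU-β coupling). PHYSICS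
VERDICT: conjecturally TRUE for the LIMIT but the conjectured exponential RATE `e^{-N/ℓ}` is
doubtful: the quartic GRADIENT vertex carries a factor vanishing at `k → 0`, so the thermal damping
rate `Γ(k) = O(k²)` and the mode-resolved mean free path `ℓ(k) = v(k)/Γ(k) → ∞` at the lower band
edge; the coherent channel is then closed only by the band-edge suppression of the bath
transmission (`𝒯(k) → 0` as the group velocity `v(k) → 0`), giving a POWER-LAW decay of
`N ∫ r_N²`. So `0 < lam` is what a proof should use to get `k`-uniform damping; `0 < β` is the
dispensable one. (This also says: a proof strategy that only uses `0 < β` must handle transparent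
long waves.) No Lean kill available. MD (kit j008037, `T = 2`, `N = 128`, `lam = 0`, `β = 1`):
`I_128 = 1.102(17)·10⁻²`, `S_128 = 1.41` — 4.4 % of the ballistic `T²/16` still transmitted
coherently at `N = 128` (vs `< 10⁻³ %` for `lam = 1`): the prediction is confirmed, `0 < lam` is
numerically load-bearing at every accessible `N`. [folklore] -/
def CoherentDephasingWithoutPosLam : Prop :=
  ∀ ω₂ β γ : ℝ, 0 < ω₂ → 0 < β → 0 < γ → ∀ T : ℝ, 0 < T → SliceAt ω₂ 0 β γ T

-- NB. The crux implies NEITHER single-drop variant (they concern parameter points outside its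
-- hypotheses). The weak-coupling support item (stmt-11813) is a formal corollary of the crux
-- (`ε₀ := 1`), attached as evidence by earlier refuters; it is deliberately NOT restated here, so
-- that no audit reads this work file as a landing of 11813.

/-! ### §4 Natural strengthenings (documented; none is claimable as a kill of the crux) -/

/-- STRENGTHENING "uniform in the temperature": `sup_T N ∫ r_N² → 0`. Conjecturally FALSE: by the
exact scaling conjugacy `(q,p) ↦ √T (q',p')`, `(lam, β, T) ≡ (lam·T, β·T, 1)` and `r_N ↦ T r_N'`,
so `N ∫ r_N²/T²` at `(lam, β, T)` equals the same quantity at `(lam T, β T, 1)`; `T → 0` is the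
harmonic limit where the coherent channel persists (ℓ(T) ~ (lam T)⁻²). Not provable here (needs
`HarmonicCoherentPersistence` plus continuity of `r_N` in the couplings at fixed `N`, neither in
the tree). Recorded so that no prover states a `T`-uniform lemma. [folklore] -/
def CoherentDephasingUniformInT : Prop :=
  ∀ ω₂ lam β γ : ℝ, 0 < ω₂ → 0 < lam → 0 < β → 0 < γ →
    Tendsto (fun N : ℕ => ⨆ T : Set.Ioi (0 : ℝ),
      (N : ℝ) * ∫ t in Ioi (0 : ℝ), (rN ω₂ lam β γ T N t / T) ^ 2) atTop (𝓝 0)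

/-- STRENGTHENING "monotone in the temperature" (the scale-free coherent functional
`S_N(T) := N ∫ r_N²/T²` is non-increasing in `T` for EVERY `N`; by §8 the same as monotonicity up
the coupling ray `g ↦ (g·lam, g·β)` at `T = 1` — the `C = 0` / `A = 0` cases of the cards'
`RayGrowthBound` / `HeatingNeverRecoheres`). MD VERDICT (kit j014774–7): NOT violated on the
diagonal ray `lam = β = 1` at any measured `N ∈ {4,…,128}` and `g ∈ {0.5,…,8}` (`S_N/T²` decreases
in `g` at every fixed `N`; attenuation length `L(g) = 7.4, 4.7, 3.2, 2.8, 2.2`), so my small-`N`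
guess (renormalised-harmonic transmission rising with `T`) does not materialise there. But the
neighbouring `lam = 0` chain (outside the crux) IS non-monotone along its ray (`L = 56, 45, 54`,
`S_128/T² = .53, .35, .49` at `g = 0.5, 2, 8`: strong gradient anharmonicity stiffens the chain
relative to its pinning and re-opens the acoustic window), but on the rays `lam : β = 0.3` and `0.1`
INSIDE the crux's family (kit j014957–9) `S_N/T²` is again monotone decreasing in `g` at every
`N ≤ 128` (e.g. ray 0.1, `N = 64`: `.406, .079, .013` at `g = 0.5, 2, 8`): 10 % on-site
anharmonicity already removes the re-coherence. So: NOT REFUTED anywhere in `0.1 ≤ lam/β ≤ 1`,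
`0.5 ≤ g ≤ 8`, `N ≤ 128`; conjecturally true for `lam > 0`, false exactly on the excluded boundary
`lam = 0`. Recorded, not decided. [folklore] -/
def SliceMonotoneInT : Prop :=
  ∀ ω₂ lam β γ : ℝ, 0 < ω₂ → 0 < lam → 0 < β → 0 < γ → ∀ N : ℕ, ∀ T T' : ℝ, 0 < T → T ≤ T' →
    (N : ℝ) * (∫ t in Ioi (0 : ℝ), rN ω₂ lam β γ T' N t ^ 2) / T' ^ 2 ≤
      (N : ℝ) * (∫ t in Ioi (0 : ℝ), rN ω₂ lam β γ T N t ^ 2) / T ^ 2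

/-! ### §7 Kill switches (what a refutation must exhibit, formally) -/

/-- If `N · b_N → 0` then `b_N → 0` (for any real sequence). [folklore] -/
theorem tendsto_zero_of_tendsto_natMul_zero {b : ℕ → ℝ}
    (h : Tendsto (fun N : ℕ => (N : ℝ) * b N) atTop (𝓝 0)) : Tendsto b atTop (𝓝 0) := by
  have hinv : Tendsto (fun N : ℕ => (N : ℝ)⁻¹) atTop (𝓝 0) :=
    tendsto_inv_atTop_zero.comp tendsto_natCast_atTop_atTop
  have hprod := h.mul hinv
  rw [zero_mul] at hprod
  refine hprod.congr' ?_
  filter_upwards [eventually_gt_atTop 0] with N hN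
  have hN' : (N : ℝ) ≠ 0 := Nat.cast_ne_zero.2 (Nat.pos_iff_ne_zero.1 hN)
  field_simp

/-- **Kill switch 1 (coherent conductance not vanishing).** If at some admissible parameter point
the un-normalised coherent channel `∫₀^∞ r_N²` (∝ the Landauer-type part of the two-terminal
conductance) does not tend to `0`, the crux is false. [folklore] -/
theorem not_sliceAt_of_not_tendsto_integral {ω₂ lam β γ T : ℝ}
    (h : ¬ Tendsto (fun N : ℕ => ∫ t in Ioi (0 : ℝ), rN ω₂ lam β γ T N t ^ 2) atTop (𝓝 0)) :
    ¬ SliceAt ω₂ lam β γ T := fun hs =>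
  h (tendsto_zero_of_tendsto_natMul_zero hs.2)

/-- **Kill switch 2 (a `c/N` floor).** If at some admissible parameter point `N ∫₀^∞ r_N² ≥ c > 0`
for infinitely many `N` (e.g. an odd hidden conserved quantity transporting the kick coherently, a
transparent band, or finite-`N` transmission resonances leaving a `c/N` share), the crux is false.
[folklore] -/
theorem not_sliceAt_of_frequently_ge {ω₂ lam β γ T c : ℝ} (hc : 0 < c)
    (h : ∃ᶠ N : ℕ in atTop, c ≤ (N : ℝ) * ∫ t in Ioi (0 : ℝ), rN ω₂ lam β γ T N t ^ 2) :
    ¬ SliceAt ω₂ lam β γ T := by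
  intro hs
  have hev : ∀ᶠ N : ℕ in atTop, (N : ℝ) * ∫ t in Ioi (0 : ℝ), rN ω₂ lam β γ T N t ^ 2 < c :=
    hs.2.eventually (gt_mem_nhds hc)
  obtain ⟨N, hge, hlt⟩ := (h.and_eventually hev).exists
  exact absurd hlt (not_lt.2 hge)

/-- **Kill switch 3 (non-integrability at one `N`).** If for some admissible parameters and some
`N` the function `t ↦ r_N(t)²` is NOT integrable on `(0,∞)` (no decay of the equilibrium end-to-end
momentum correlation of the FINITE open chain — excluded in substance by CEHR 2018 exponential
ergodicity, conditions C1–C5 holding for `lam, β > 0`), the crux is false. [folklore] -/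
theorem not_sliceAt_of_not_integrableOn {ω₂ lam β γ T : ℝ} {N : ℕ}
    (h : ¬ IntegrableOn (fun t : ℝ => rN ω₂ lam β γ T N t ^ 2) (Ioi 0)) :
    ¬ SliceAt ω₂ lam β γ T := fun hs => h (hs.1 N)

/-- Any kill at an admissible point kills the crux. [folklore] -/
theorem not_coherentDephasing_of_not_sliceAt {ω₂ lam β γ T : ℝ} (hω : 0 < ω₂) (hl : 0 < lam)
    (hβ : 0 < β) (hγ : 0 < γ) (hT : 0 < T) (h : ¬ SliceAt ω₂ lam β γ T) : ¬ CoherentDephasing :=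
  fun hC => h (hC ω₂ lam β γ hω hl hβ hγ T hT)

/-! ### §8 Scaling normal form (PROVED; `Negative/ScalingNormalForm.lean`) -/

section ScalingNormalForm
open Summit.AtomisticToContinuum.FouriersLaw.Theorems.CoherentDephasing.Negative.ScalingNormalForm

/-- **`ScalingCovariance`**: `r_N(t; lam, β, T) = T · r_N(t; lam T, β T, 1)` for `T > 0`
(`ω₂ > 0`, `lam, β, γ ≥ 0` — includes the harmonic corner). [folklore] -/
theorem rN_eq_temp_mul_unit {ω₂ lam β γ T : ℝ} (hω : 0 < ω₂) (hl : 0 ≤ lam) (hβ : 0 ≤ β)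
    (hγ : 0 ≤ γ) (hT : 0 < T) (N : ℕ) (t : ℝ) :
    rN ω₂ lam β γ T N t = T * rN ω₂ (lam * T) (β * T) γ 1 N t :=
  pairCorr_eq_temp_mul_unit hω hl hβ hγ hT N t

/-- More generally `r_N(t; lam, β, T) = s² · r_N(t; lam s², β s², T/s²)` for `s > 0`. [folklore] -/
theorem rN_smul {ω₂ lam β γ s : ℝ} (hω : 0 < ω₂) (hl : 0 ≤ lam) (hβ : 0 ≤ β) (hγ : 0 ≤ γ)
    (hs : 0 < s) (N : ℕ) (T t : ℝ) :
    rN ω₂ lam β γ T N t = s ^ 2 * rN ω₂ (lam * s ^ 2) (β * s ^ 2) γ (T / s ^ 2) N t :=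
  pairCorr_smul hω hl hβ hγ hs N T t

/-- **The `T`-slice at `(lam, β)` is the unit-temperature slice at `(lam T, β T)`.** [folklore] -/
theorem sliceAt_iff_unit {ω₂ lam β γ T : ℝ} (hω : 0 < ω₂) (hl : 0 ≤ lam) (hβ : 0 ≤ β) (hγ : 0 ≤ γ)
    (hT : 0 < T) : SliceAt ω₂ lam β γ T ↔ SliceAt ω₂ (lam * T) (β * T) γ 1 :=
  slice_iff_of_eq_const_mul hT.ne' (fun N t => rN_eq_temp_mul_unit hω hl hβ hγ hT N t)

/-- **Normal form of the crux: its `T = 1` slice over all couplings.** [folklore] -/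
theorem coherentDephasing_iff_unitTemperature :
    CoherentDephasing ↔ ∀ ω₂ lam β γ : ℝ, 0 < ω₂ → 0 < lam → 0 < β → 0 < γ → SliceAt ω₂ lam β γ 1 :=
  coherentDephasing_iff_unit_temperature

/-- Hence a refutation needs exactly ONE coupling pair `(a, b) > 0` (and `ω₂, γ > 0`) at which the
unit-temperature slice fails (combine with the §7 kill switches). [folklore] -/
theorem not_coherentDephasing_of_not_sliceAt_one {ω₂ a b γ : ℝ} (hω : 0 < ω₂) (ha : 0 < a)
    (hb : 0 < b) (hγ : 0 < γ) (h : ¬ SliceAt ω₂ a b γ 1) : ¬ CoherentDephasing := fun hC =>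
  h (coherentDephasing_iff_unitTemperature.1 hC ω₂ a b γ hω ha hb hγ)

/-- The scale-free functional `S_N(T) = N ∫ r_N²/T²` at `(lam, β, T)` equals `N ∫ r_N²` at
`(lam T, β T, 1)`: temperature-monotonicity (`SliceMonotoneInT`) is monotonicity up the coupling
ray. [folklore] -/
theorem scaleFree_eq_unit {ω₂ lam β γ T : ℝ} (hω : 0 < ω₂) (hl : 0 ≤ lam) (hβ : 0 ≤ β)
    (hγ : 0 ≤ γ) (hT : 0 < T) (N : ℕ) :
    (N : ℝ) * (∫ t in Ioi (0 : ℝ), rN ω₂ lam β γ T N t ^ 2) / T ^ 2 =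
      (N : ℝ) * ∫ t in Ioi (0 : ℝ), rN ω₂ (lam * T) (β * T) γ 1 N t ^ 2 := by
  have h : (fun t => rN ω₂ lam β γ T N t ^ 2) = fun t => T ^ 2 * rN ω₂ (lam * T) (β * T) γ 1 N t ^ 2 := by
    funext t; rw [rN_eq_temp_mul_unit hω hl hβ hγ hT N t]; ring
  rw [h, integral_const_mul]
  field_simp

/-- **The weak-coupling support item (stmt-11813) is the small-coupling CORNER of the normal form**:
`CoherentDephasingWeakCoupling ↔ ∀ ω₂ γ > 0, ∃ ε₀ > 0, ∀ a b ∈ (0, ε₀], SliceAt ω₂ a b γ 1`. So the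
route's foreseen regime split is a split of the coupling quadrant at `T = 1` (corner + complement),
not a split of the temperature axis. [folklore] -/
theorem weakCoupling_iff_corner :
    CoherentDephasingWeakCoupling ↔ ∀ ω₂ γ : ℝ, 0 < ω₂ → 0 < γ → ∃ ε₀ : ℝ, 0 < ε₀ ∧
      ∀ a b : ℝ, 0 < a → 0 < b → a ≤ ε₀ → b ≤ ε₀ → SliceAt ω₂ a b γ 1 := by
  constructor
  · intro h ω₂ γ hω hγ
    obtain ⟨ε₀, hε, hc⟩ := h ω₂ γ hω hγ
    refine ⟨ε₀, hε, fun a b ha hb hae hbe => ?_⟩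
    have := hc a b 1 ha hb one_pos (by simpa using hae) (by simpa using hbe)
    exact this
  · intro h ω₂ γ hω hγ
    obtain ⟨ε₀, hε, hc⟩ := h ω₂ γ hω hγ
    refine ⟨ε₀, hε, fun lam β T hl hβ hT hlT hβT => ?_⟩
    exact (sliceAt_iff_unit hω hl.le hβ.le hγ.le hT).2
      (hc (lam * T) (β * T) (by positivity) (by positivity) hlT hβT)

end ScalingNormalForm

end Summit.AtomisticToContinuum.FouriersLaw.Cruxes.CoherentDephasing.Disproof
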